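import Summits.AtomisticToContinuum.Crystallization.Theorems.OverbindingBudgetAffineFarFieldCellRD
import Summits.AtomisticToContinuum.Crystallization.Theorems.OverbindingBudgetAffineFarFieldFrameRows
import Literature.Geometry.DiscreteGeometry.KissingPatterns

/-!
# Overbinding budget — far-field Voronoi cells, part 27V-T «CellFacets»: facet prisms of the `k`-cell

Route `OverbindingBudget`, crux `RobustDefectLimitWindows` (stmt-31280), line (2c), leaf SW♭(30),
part 27V-T (tube row of the CORE–collar interface), convention-bound half of item T4 (critic
★ r1738 (B) «T4 SHAPE OF RECORD: parallelogram prism per facet via `volume_image_box`»).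
«CollarKit» reduces the `u`-tube about a collar facet to the chart image of a CAP
`K ∩ {x | ‖v‖²(1 - λ'/2)/λ ≤ ⟪x, v⟫}` of the ideal cell at the bond `v` (`inter_subset_image_cap`) and
prices a box pushed forward by a frame `T` through its LOWER ROW and `|det T|`
(`cthickening_image_subset`, `cthickening_coordBox_subset`, `volume_image_box`).  Here, for the ideal
`k`-cell `rdCell h` (bonds `v = 2h·w`, `w ∈ fccInt`, `‖v‖² = 8h²`, facet plane `⟪x, v⟫ = 4h²`):
every cap `rdCell h ∩ {x | 4h²(1 - ε) ≤ ⟪x, 2h·w⟫}` lies in a FACET PRISM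
`p + T '' ([-ε/2, 1 + ε/2]² × [-ε, 0])` with `|det T| = 4h³`, lower row `√2·h`, `T` onto
(`rdCell_cap_subset_prism`); `∏ sides = (1 + ε)²·ε` (`facetBox_sides`), so the prism has volume
`4h³ε(1 + ε)²` = rhombus area `2√2·h²` × depth `√2·h·ε` × `(1 + ε)²` — the B2b row EXACTLY.
§1 frame maps `x ↦ x₀c₀ + x₁c₁ + x₂c₂` (Sarrus determinant, onto from a lower row) and TRANSPORT of a
cap-in-prism statement along a cell symmetry; §2 the base facet `x₀ + x₁ = 2h` (apex `(2h,0,0)`,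
columns `h(-1,1,1)`, `h(-1,1,-1)` = rhombus edges, `h(1,1,0)` = normal; explicit inverse
coordinates); §3 the signed permutations generated by `flipIso k`, `cycIso` (cell symmetries) act
transitively on `fccInt`.  Pure analysis on `ℝ³`, atlas-free; the `h`-cell is «CellFacetsTRD».
-/


namespace Summit.AtomisticToContinuum.Crystallization.Theorems.OverbindingBudgetAffineFarFieldCellFacets

noncomputable section

open Set MeasureTheory Metric
open scoped Pointwise
open Literature.Geometry.DiscreteGeometry (intVec intVec_apply fccInt)
open Summit.AtomisticToContinuum.Crystallization.Theorems.OverbindingBudgetAffineFarFieldCellRD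
open Summit.AtomisticToContinuum.Crystallization.Theorems.OverbindingBudgetAffineFarFieldCellSymm
open Summit.AtomisticToContinuum.Crystallization.Theorems.OverbindingBudgetAffineFarFieldFrameRows
  (abs_det_eq_one_of_norm_eq)

local notation "E3" => EuclideanSpace ℝ (Fin 3)

/-! ## §1 Frame maps on `ℝ³` and transport along cell symmetries -/

/-- support: the linear map of `ℝ³` with columns `c₀, c₁, c₂`: `x ↦ x₀•c₀ + x₁•c₁ + x₂•c₂`. -/
def columnFrame (c₀ c₁ c₂ : E3) : E3 →L[ℝ] E3 :=
  (EuclideanSpace.proj 0).smulRight c₀ + (EuclideanSpace.proj 1).smulRight c₁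
    + (EuclideanSpace.proj 2).smulRight c₂

/-- Coordinates of a frame map. -/
theorem columnFrame_apply (c₀ c₁ c₂ x : E3) (i : Fin 3) :
    columnFrame c₀ c₁ c₂ x i = x 0 * c₀ i + x 1 * c₁ i + x 2 * c₂ i := by
  simp [columnFrame]

/-- DETERMINANT of a frame map (rule of Sarrus on the columns). -/
theorem det_columnFrame (c₀ c₁ c₂ : E3) :
    (columnFrame c₀ c₁ c₂).det
      = c₀ 0 * c₁ 1 * c₂ 2 - c₀ 0 * c₁ 2 * c₂ 1 - c₀ 1 * c₁ 0 * c₂ 2 + c₀ 1 * c₁ 2 * c₂ 0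
        + c₀ 2 * c₁ 0 * c₂ 1 - c₀ 2 * c₁ 1 * c₂ 0 := by
  have hdet : (columnFrame c₀ c₁ c₂).det = (LinearMap.toMatrix (EuclideanSpace.basisFun (Fin 3) ℝ).toBasis
      (EuclideanSpace.basisFun (Fin 3) ℝ).toBasis (columnFrame c₀ c₁ c₂ : E3 →ₗ[ℝ] E3)).det := by
    rw [LinearMap.det_toMatrix]
  rw [hdet, Matrix.det_fin_three]
  simp [LinearMap.toMatrix_apply, columnFrame]
  ring

/-- A linear map of `ℝ³` with a positive lower row is ONTO (injective endomorphism of a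
finite-dimensional space). -/
theorem surjective_of_lower_row (T : E3 →L[ℝ] E3) {a : ℝ} (ha : 0 < a)
    (hlow : ∀ x, a * ‖x‖ ≤ ‖T x‖) : Function.Surjective T := by
  have hinj : Function.Injective (T : E3 →ₗ[ℝ] E3) := by
    rw [injective_iff_map_eq_zero]
    intro x hx
    have h1 := hlow x
    rw [show (T : E3 →ₗ[ℝ] E3) x = T x from rfl] at hx
    rw [hx, norm_zero] at h1
    have h2 : ‖x‖ ≤ 0 := by nlinarith [norm_nonneg x]
    exact norm_le_zero_iff.1 h2
  exact LinearMap.injective_iff_surjective.1 hinj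

/-- The lower row survives composition with a norm-preserving map on the left. -/
theorem lower_row_comp_of_norm_eq (G T : E3 →L[ℝ] E3) (hG : ∀ u, ‖G u‖ = ‖u‖) {a : ℝ}
    (hlow : ∀ x, a * ‖x‖ ≤ ‖T x‖) (x : E3) : a * ‖x‖ ≤ ‖(G.comp T) x‖ := by
  rw [ContinuousLinearMap.comp_apply, hG]
  exact hlow x

/-- `|det|` survives composition with a norm-preserving map on the left (`|det G| = 1`, FrameRows). -/
theorem abs_det_comp_of_norm_eq_left (G T : E3 →L[ℝ] E3) (hG : ∀ u, ‖G u‖ = ‖u‖) :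
    |(G.comp T).det| = |T.det| := by
  have e : (G.comp T).det = G.det * T.det := by
    unfold ContinuousLinearMap.det
    rw [← LinearMap.det_comp]; rfl
  rw [e, abs_mul, abs_det_eq_one_of_norm_eq G hG, one_mul]

/-- The continuous linear map of a linear isometry equivalence, pointwise. -/
theorem isometry_clm_apply (g : E3 ≃ₗᵢ[ℝ] E3) (x : E3) :
    g.toLinearIsometry.toContinuousLinearMap x = g x := rfl

/-- TRANSPORT of a cap-in-prism statement along a linear isometry `g` whose inverse maps `K` into
itself: the cap of `K` at the bond `g v` lies in the `g`-image of the prism at `v`. -/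
theorem cap_subset_prism_transport {K B : Set E3} (g : E3 ≃ₗᵢ[ℝ] E3)
    (hK : ∀ x ∈ K, g.symm x ∈ K) {v p : E3} {β : ℝ} {T : E3 →L[ℝ] E3}
    (h : K ∩ {x | β ≤ inner ℝ x v} ⊆ (fun x => p + T x) '' B) :
    K ∩ {x | β ≤ inner ℝ x (g v)} ⊆
      (fun x => g p + (g.toLinearIsometry.toContinuousLinearMap.comp T) x) '' B := by
  rintro x ⟨hxK, hxv⟩
  have hy : g.symm x ∈ K ∩ {x | β ≤ inner ℝ x v} := by
    refine ⟨hK x hxK, ?_⟩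
    rw [mem_setOf_eq] at hxv ⊢
    have e : inner ℝ (g.symm x) v = inner ℝ x (g v) := by
      rw [← g.inner_map_map (g.symm x) v, LinearIsometryEquiv.apply_symm_apply]
    rwa [e]
  obtain ⟨b, hb, hbx⟩ := h hy
  refine ⟨b, hb, ?_⟩
  have e : x = g (g.symm x) := (g.apply_symm_apply x).symm
  rw [e, ← hbx]
  show g p + (g.toLinearIsometry.toContinuousLinearMap.comp T) b = g (p + T b)
  rw [ContinuousLinearMap.comp_apply, isometry_clm_apply, map_add]

/-- Symmetries of a cell about `0` in the sense of part 27Vb-S map the cell into itself. -/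
theorem mem_of_isInvariantUnder {K : Set E3} {g : E3 ≃ₗᵢ[ℝ] E3} (hg : IsInvariantUnder K 0 g)
    {x : E3} (hx : x ∈ K) : g x ∈ K := by
  simpa using hg x hx

/-- Conversely, a linear isometry mapping the cell into itself is a symmetry about `0`. -/
theorem isInvariantUnder_of_mapsTo {K : Set E3} {g : E3 ≃ₗᵢ[ℝ] E3} (hg : ∀ x ∈ K, g x ∈ K) :
    IsInvariantUnder K 0 g := by
  intro x hx
  simpa using hg x hx

/-- Symmetries about `0` compose. -/
theorem isInvariantUnder_trans {K : Set E3} {e₁ e₂ : E3 ≃ₗᵢ[ℝ] E3} (h₁ : IsInvariantUnder K 0 e₁)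
    (h₂ : IsInvariantUnder K 0 e₂) : IsInvariantUnder K 0 (e₁.trans e₂) :=
  isInvariantUnder_of_mapsTo fun x hx => by
    rw [LinearIsometryEquiv.trans_apply]
    exact mem_of_isInvariantUnder h₂ (mem_of_isInvariantUnder h₁ hx)

/-! ## §2 The base facet `x₀ + x₁ = 2h` of the `k`-cell -/

/-- The pairing with the scaled integer bond vector `2h·w`, in coordinates. -/
theorem inner_two_h_intVec (h : ℝ) (x : E3) (w : Fin 3 → ℤ) :
    inner ℝ x ((2 * h) • intVec w) = 2 * h * ((w 0 : ℝ) * x 0 + (w 1 : ℝ) * x 1 + (w 2 : ℝ) * x 2) := by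
  rw [real_inner_smul_right]
  simp only [EuclideanSpace.inner_eq_star_dotProduct, dotProduct, Fin.sum_univ_three, intVec_apply,
    star_trivial]

/-- The base facet frame: columns `h(-1,1,1)`, `h(-1,1,-1)` (rhombus edges at the apex `(2h,0,0)`) and
`h(1,1,0)` (facet normal) — evaluation in coordinates. -/
theorem baseFrame_apply (h : ℝ) (x : E3) :
    columnFrame (h • intVec ![-1, 1, 1]) (h • intVec ![-1, 1, -1]) (h • intVec ![1, 1, 0]) x 0
        = h * (-x 0 - x 1 + x 2) ∧
      columnFrame (h • intVec ![-1, 1, 1]) (h • intVec ![-1, 1, -1]) (h • intVec ![1, 1, 0]) x 1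
        = h * (x 0 + x 1 + x 2) ∧
      columnFrame (h • intVec ![-1, 1, 1]) (h • intVec ![-1, 1, -1]) (h • intVec ![1, 1, 0]) x 2
        = h * (x 0 - x 1) := by
  refine ⟨?_, ?_, ?_⟩ <;>
  · rw [columnFrame_apply]
    simp only [PiLp.smul_apply, smul_eq_mul, intVec_apply, Matrix.cons_val_zero, Matrix.cons_val_one,
      Matrix.cons_val_two, Matrix.head_cons, Matrix.tail_cons, Int.cast_one, Int.cast_zero,
      Int.cast_neg]
    ring

/-- `|det|` of the base facet frame: `4h³`. -/
theorem abs_det_baseFrame (h : ℝ) (hh : 0 ≤ h) :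
    |(columnFrame (h • intVec ![-1, 1, 1]) (h • intVec ![-1, 1, -1]) (h • intVec ![1, 1, 0])).det|
      = 4 * h ^ 3 := by
  rw [det_columnFrame]
  simp only [PiLp.smul_apply, smul_eq_mul, intVec_apply, Matrix.cons_val_zero, Matrix.cons_val_one,
    Matrix.cons_val_two, Matrix.head_cons, Matrix.tail_cons, Int.cast_one, Int.cast_zero,
    Int.cast_neg]
  rw [show h * -1 * (h * 1) * (h * 0) - h * -1 * (h * -1) * (h * 1) - h * 1 * (h * -1) * (h * 0)
      + h * 1 * (h * -1) * (h * 1) + h * 1 * (h * -1) * (h * 1) - h * 1 * (h * 1) * (h * 1)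
      = -(4 * h ^ 3) by ring, abs_neg, abs_of_nonneg (by positivity)]

/-- LOWER ROW of the base facet frame: `√2·h·‖x‖ ≤ ‖T x‖` (Gram matrix `h²·[[3,1,0],[1,3,0],[0,0,2]]`,
least eigenvalue `2h²`: `‖T x‖² - 2h²‖x‖² = h²(x₀ + x₁)²`). -/
theorem lower_row_baseFrame (h : ℝ) (hh : 0 ≤ h) (x : E3) :
    Real.sqrt 2 * h * ‖x‖
      ≤ ‖columnFrame (h • intVec ![-1, 1, 1]) (h • intVec ![-1, 1, -1]) (h • intVec ![1, 1, 0]) x‖ := by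
  obtain ⟨e0, e1, e2⟩ := baseFrame_apply h x
  set y := columnFrame (h • intVec ![-1, 1, 1]) (h • intVec ![-1, 1, -1]) (h • intVec ![1, 1, 0]) x
  have hx : ‖x‖ ^ 2 = x 0 ^ 2 + x 1 ^ 2 + x 2 ^ 2 := by
    rw [EuclideanSpace.norm_sq_eq, Fin.sum_univ_three]
    simp only [Real.norm_eq_abs, sq_abs]
  have hy : ‖y‖ ^ 2 = y 0 ^ 2 + y 1 ^ 2 + y 2 ^ 2 := by
    rw [EuclideanSpace.norm_sq_eq, Fin.sum_univ_three]
    simp only [Real.norm_eq_abs, sq_abs]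
  have key : (Real.sqrt 2 * h * ‖x‖) ^ 2 ≤ ‖y‖ ^ 2 := by
    rw [mul_pow, mul_pow, Real.sq_sqrt zero_le_two, hx, hy, e0, e1, e2]
    nlinarith [sq_nonneg (x 0 + x 1), sq_nonneg h]
  have h0 : 0 ≤ Real.sqrt 2 * h * ‖x‖ := by positivity
  exact (pow_le_pow_iff_left₀ h0 (norm_nonneg _) two_ne_zero).1 key

/-- ★ The BASE FACET CAP in its prism: for `0 < h`, `0 ≤ ε`,
`rdCell h ∩ {4h²(1 - ε) ≤ ⟪x, 2h·(1,1,0)⟫} ⊆ (2h,0,0) + T '' ([-ε/2, 1 + ε/2]² × [-ε, 0])`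
with `T` the base facet frame (inverse coordinates `a = (x₁ - x₀ + 2h + 2x₂)/(4h)`,
`b = (x₁ - x₀ + 2h - 2x₂)/(4h)`, `t = (x₀ + x₁ - 2h)/(2h)`; each bound is one pair of `rdCell`
inequalities plus the cap inequality `2h(1 - ε) ≤ x₀ + x₁`). -/
theorem rdCell_baseCap_subset_prism {h : ℝ} (hh : 0 < h) (ε : ℝ) :
    rdCell h ∩ {x | 4 * h ^ 2 * (1 - ε) ≤ inner ℝ x ((2 * h) • intVec ![1, 1, 0])} ⊆
      (fun x => (2 * h) • intVec ![1, 0, 0]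
          + columnFrame (h • intVec ![-1, 1, 1]) (h • intVec ![-1, 1, -1]) (h • intVec ![1, 1, 0]) x) ''
        {x : E3 | ∀ i, ![-(ε / 2), -(ε / 2), -ε] i ≤ x i ∧ x i ≤ ![1 + ε / 2, 1 + ε / 2, 0] i} := by
  set T₀ := columnFrame (h • intVec ![-1, 1, 1]) (h • intVec ![-1, 1, -1]) (h • intVec ![1, 1, 0]) with hT₀
  rintro u ⟨hu, hcap⟩
  rw [mem_setOf_eq, inner_two_h_intVec] at hcap
  simp only [Matrix.cons_val_zero, Matrix.cons_val_one, Matrix.cons_val_two, Matrix.head_cons,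
    Matrix.tail_cons, Int.cast_one, Int.cast_zero, one_mul, zero_mul, add_zero] at hcap
  have hc : 2 * h * (1 - ε) ≤ u 0 + u 1 := by
    have : 2 * h * (2 * h * (1 - ε)) ≤ 2 * h * (u 0 + u 1) := by nlinarith
    exact le_of_mul_le_mul_left this (by positivity)
  obtain ⟨h01, h02, h12⟩ := mem_rdCell_iff.1 hu
  have a0 := le_abs_self (u 0); have b0 := neg_abs_le (u 0)
  have a1 := le_abs_self (u 1); have b1 := neg_abs_le (u 1)
  have a2 := le_abs_self (u 2); have b2 := neg_abs_le (u 2)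
  set a : ℝ := (u 1 - u 0 + 2 * h + 2 * u 2) / (4 * h) with ha
  set b : ℝ := (u 1 - u 0 + 2 * h - 2 * u 2) / (4 * h) with hb
  set t : ℝ := (u 0 + u 1 - 2 * h) / (2 * h) with ht
  obtain ⟨h4, h2⟩ : 0 < 4 * h ∧ 0 < 2 * h := ⟨by positivity, by positivity⟩
  refine ⟨WithLp.toLp 2 ![a, b, t], ?_, ?_⟩
  · intro i
    fin_cases i
    · show -(ε / 2) ≤ a ∧ a ≤ 1 + ε / 2
      exact ⟨by rw [ha, le_div_iff₀ h4]; nlinarith, by rw [ha, div_le_iff₀ h4]; nlinarith⟩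
    · show -(ε / 2) ≤ b ∧ b ≤ 1 + ε / 2
      exact ⟨by rw [hb, le_div_iff₀ h4]; nlinarith, by rw [hb, div_le_iff₀ h4]; nlinarith⟩
    · show -ε ≤ t ∧ t ≤ 0
      exact ⟨by rw [ht, le_div_iff₀ h2]; nlinarith, by rw [ht, div_le_iff₀ h2]; nlinarith⟩
  · obtain ⟨e0, e1, e2⟩ := baseFrame_apply h (WithLp.toLp 2 ![a, b, t])
    rw [← hT₀] at e0 e1 e2
    ext i
    fin_cases i
    · show ((2 * h) • intVec ![1, 0, 0] + T₀ (WithLp.toLp 2 ![a, b, t])) 0 = u 0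
      rw [PiLp.add_apply, e0]
      simp only [PiLp.smul_apply, smul_eq_mul, intVec_apply, Matrix.cons_val_zero,
        Matrix.cons_val_one, Matrix.cons_val_two, Matrix.head_cons, Matrix.tail_cons, Int.cast_one]
      rw [ha, hb, ht]; field_simp; ring
    · show ((2 * h) • intVec ![1, 0, 0] + T₀ (WithLp.toLp 2 ![a, b, t])) 1 = u 1
      rw [PiLp.add_apply, e1]
      simp only [PiLp.smul_apply, smul_eq_mul, intVec_apply, Matrix.cons_val_zero,
        Matrix.cons_val_one, Matrix.cons_val_two, Matrix.head_cons, Matrix.tail_cons, Int.cast_zero]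
      rw [ha, hb, ht]; field_simp; ring
    · show ((2 * h) • intVec ![1, 0, 0] + T₀ (WithLp.toLp 2 ![a, b, t])) 2 = u 2
      rw [PiLp.add_apply, e2]
      simp only [PiLp.smul_apply, smul_eq_mul, intVec_apply, Matrix.cons_val_zero,
        Matrix.cons_val_one, Matrix.cons_val_two, Matrix.head_cons, Matrix.tail_cons, Int.cast_zero]
      rw [ha, hb]; field_simp; ring

/-- The box of the facet prism has side product `(1 + ε)²·ε` (so the prism has volume
`|det T|·(1 + ε)²·ε = 4h³ε(1 + ε)²` by `volume_image_box`), and is a genuine box for `0 ≤ ε`. -/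
theorem facetBox_sides (ε : ℝ) :
    (∏ i : Fin 3, (![1 + ε / 2, 1 + ε / 2, 0] i - ![-(ε / 2), -(ε / 2), -ε] i)) = (1 + ε) ^ 2 * ε := by
  rw [Fin.prod_univ_three]
  simp only [Matrix.cons_val_zero, Matrix.cons_val_one, Matrix.cons_val_two, Matrix.head_cons,
    Matrix.tail_cons]
  ring

/-- The box is non-degenerate (`lᵢ ≤ hᵢ`) for `0 ≤ ε`. -/
theorem facetBox_le {ε : ℝ} (hε : 0 ≤ ε) (i : Fin 3) :
    ![-(ε / 2), -(ε / 2), -ε] i ≤ ![1 + ε / 2, 1 + ε / 2, 0] i := by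
  fin_cases i
  · show -(ε / 2) ≤ 1 + ε / 2; linarith
  · show -(ε / 2) ≤ 1 + ε / 2; linarith
  · show -ε ≤ 0; linarith

/-! ## §3 The twelve facets of the `k`-cell -/

/-- A coordinate flip on integer vectors. -/
theorem flipIso_intVec (k : Fin 3) (w : Fin 3 → ℤ) :
    flipIso k (intVec w) = intVec (fun i => if i = k then -w i else w i) := by
  ext i
  rw [flipIso_apply]
  simp only [intVec_apply]
  split_ifs <;> push_cast <;> ring

/-- `flipIso 0` on integer vectors. -/
theorem flipIso_zero_intVec (w : Fin 3 → ℤ) : flipIso 0 (intVec w) = intVec ![-w 0, w 1, w 2] := by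
  rw [flipIso_intVec]; congr 1; ext i; fin_cases i <;> simp

/-- `flipIso 1` on integer vectors. -/
theorem flipIso_one_intVec (w : Fin 3 → ℤ) : flipIso 1 (intVec w) = intVec ![w 0, -w 1, w 2] := by
  rw [flipIso_intVec]; congr 1; ext i; fin_cases i <;> simp

/-- `flipIso 2` on integer vectors. -/
theorem flipIso_two_intVec (w : Fin 3 → ℤ) : flipIso 2 (intVec w) = intVec ![w 0, w 1, -w 2] := by
  rw [flipIso_intVec]; congr 1; ext i; fin_cases i <;> simp

/-- The 3-cycle on integer vectors. -/
theorem cycIso_intVec (w : Fin 3 → ℤ) : cycIso (intVec w) = intVec ![w 2, w 0, w 1] := by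
  ext i
  fin_cases i
  · show cycIso (intVec w) 0 = _; rw [cycIso_apply_zero]; simp
  · show cycIso (intVec w) 1 = _; rw [cycIso_apply_one]; simp
  · show cycIso (intVec w) 2 = _; rw [cycIso_apply_two]; simp

/-- ★ TRANSITIVITY: every bond direction `w ∈ fccInt` is the image of the base bond `(1,1,0)` under a
symmetry of `rdCell h` (about `0`, together with its inverse) — a word in the three coordinate flips
and the coordinate 3-cycle. -/
theorem exists_symmetry_of_mem_fccInt (h : ℝ) {w : Fin 3 → ℤ} (hw : w ∈ fccInt) :
    ∃ g : E3 ≃ₗᵢ[ℝ] E3, IsInvariantUnder (rdCell h) 0 g ∧ IsInvariantUnder (rdCell h) 0 g.symm ∧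
      g (intVec ![1, 1, 0]) = intVec w := by
  have iF : ∀ k, IsInvariantUnder (rdCell h) 0 (flipIso k) := rdCell_invariant_flip h
  have iFs : ∀ k, IsInvariantUnder (rdCell h) 0 (flipIso k).symm := fun k => by
    rw [flipIso_symm]; exact rdCell_invariant_flip h k
  have iC : IsInvariantUnder (rdCell h) 0 cycIso := rdCell_invariant_cyc h
  have iCs : IsInvariantUnder (rdCell h) 0 cycIso.symm := rdCell_invariant_cyc_symm h
  simp only [fccInt, Finset.mem_insert, Finset.mem_singleton] at hw
  rcases hw with rfl | rfl | rfl | rfl | rfl | rfl | rfl | rfl | rfl | rfl | rfl | rfl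
  · exact ⟨LinearIsometryEquiv.refl ℝ E3, isInvariantUnder_of_mapsTo fun x hx => hx,
      isInvariantUnder_of_mapsTo fun x hx => hx, rfl⟩
  · refine ⟨flipIso 1, iF 1, iFs 1, ?_⟩
    rw [flipIso_one_intVec]
    rfl
  · refine ⟨flipIso 0, iF 0, iFs 0, ?_⟩
    rw [flipIso_zero_intVec]
    rfl
  · refine ⟨(flipIso 1).trans (flipIso 0), isInvariantUnder_trans (iF 1) (iF 0), ?_, ?_⟩
    · rw [LinearIsometryEquiv.symm_trans]; exact isInvariantUnder_trans (iFs 0) (iFs 1)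
    · rw [LinearIsometryEquiv.trans_apply, flipIso_one_intVec, flipIso_zero_intVec]
      rfl
  · refine ⟨cycIso.trans cycIso, isInvariantUnder_trans iC iC, ?_, ?_⟩
    · rw [LinearIsometryEquiv.symm_trans]; exact isInvariantUnder_trans iCs iCs
    · rw [LinearIsometryEquiv.trans_apply, cycIso_intVec, cycIso_intVec]
      rfl
  · refine ⟨(cycIso.trans cycIso).trans (flipIso 2),
      isInvariantUnder_trans (isInvariantUnder_trans iC iC) (iF 2), ?_, ?_⟩
    · rw [LinearIsometryEquiv.symm_trans, LinearIsometryEquiv.symm_trans]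
      exact isInvariantUnder_trans (iFs 2) (isInvariantUnder_trans iCs iCs)
    · rw [LinearIsometryEquiv.trans_apply, LinearIsometryEquiv.trans_apply, cycIso_intVec,
        cycIso_intVec, flipIso_two_intVec]
      rfl
  · refine ⟨(cycIso.trans cycIso).trans (flipIso 0),
      isInvariantUnder_trans (isInvariantUnder_trans iC iC) (iF 0), ?_, ?_⟩
    · rw [LinearIsometryEquiv.symm_trans, LinearIsometryEquiv.symm_trans]
      exact isInvariantUnder_trans (iFs 0) (isInvariantUnder_trans iCs iCs)
    · rw [LinearIsometryEquiv.trans_apply, LinearIsometryEquiv.trans_apply, cycIso_intVec,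
        cycIso_intVec, flipIso_zero_intVec]
      rfl
  · refine ⟨((cycIso.trans cycIso).trans (flipIso 2)).trans (flipIso 0),
      isInvariantUnder_trans (isInvariantUnder_trans (isInvariantUnder_trans iC iC) (iF 2)) (iF 0),
      ?_, ?_⟩
    · rw [LinearIsometryEquiv.symm_trans, LinearIsometryEquiv.symm_trans,
        LinearIsometryEquiv.symm_trans]
      exact isInvariantUnder_trans (iFs 0)
        (isInvariantUnder_trans (iFs 2) (isInvariantUnder_trans iCs iCs))
    · rw [LinearIsometryEquiv.trans_apply, LinearIsometryEquiv.trans_apply,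
        LinearIsometryEquiv.trans_apply, cycIso_intVec, cycIso_intVec, flipIso_two_intVec,
        flipIso_zero_intVec]
      rfl
  · refine ⟨cycIso, iC, iCs, ?_⟩
    rw [cycIso_intVec]
    rfl
  · refine ⟨cycIso.trans (flipIso 2), isInvariantUnder_trans iC (iF 2), ?_, ?_⟩
    · rw [LinearIsometryEquiv.symm_trans]; exact isInvariantUnder_trans (iFs 2) iCs
    · rw [LinearIsometryEquiv.trans_apply, cycIso_intVec, flipIso_two_intVec]
      rfl
  · refine ⟨cycIso.trans (flipIso 1), isInvariantUnder_trans iC (iF 1), ?_, ?_⟩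
    · rw [LinearIsometryEquiv.symm_trans]; exact isInvariantUnder_trans (iFs 1) iCs
    · rw [LinearIsometryEquiv.trans_apply, cycIso_intVec, flipIso_one_intVec]
      rfl
  · refine ⟨(cycIso.trans (flipIso 2)).trans (flipIso 1),
      isInvariantUnder_trans (isInvariantUnder_trans iC (iF 2)) (iF 1), ?_, ?_⟩
    · rw [LinearIsometryEquiv.symm_trans, LinearIsometryEquiv.symm_trans]
      exact isInvariantUnder_trans (iFs 1) (isInvariantUnder_trans (iFs 2) iCs)
    · rw [LinearIsometryEquiv.trans_apply, LinearIsometryEquiv.trans_apply, cycIso_intVec,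
        flipIso_two_intVec, flipIso_one_intVec]
      rfl

/-- ★ «CellFacets» for the `k`-cell: for `0 < h`, `w ∈ fccInt` (bond `v = 2h·w`, `‖v‖² = 8h²`,
facet plane `⟪x, v⟫ = 4h² = ‖v‖²/2`) and any relative depth `ε` there are an apex `p` and a frame
`T` with `|det T| = 4h³`, lower row `√2·h`, `T` onto, and
`rdCell h ∩ {x | 4h²(1 - ε) ≤ ⟪x, v⟫} ⊆ p + T '' ([-ε/2, 1 + ε/2]² × [-ε, 0])`
(the box has `∏ (hᵢ - lᵢ) = (1 + ε)²·ε`, `facetBox_sides`; it is a box for `0 ≤ ε`, `facetBox_le`; for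
`ε < 0` the cap is empty).  With «CollarKit»: the `u`-tube about the chart image of the `λ`-scaled cap
lies in the chart image of `λp + T '' (λ·box ± u/(a·√2·h))`, of volume `|det A|·4h³·∏(sides)`. -/
theorem rdCell_cap_subset_prism {h : ℝ} (hh : 0 < h) {w : Fin 3 → ℤ} (hw : w ∈ fccInt) (ε : ℝ) :
    ∃ (p : E3) (T : E3 →L[ℝ] E3), |T.det| = 4 * h ^ 3 ∧ (∀ x, Real.sqrt 2 * h * ‖x‖ ≤ ‖T x‖) ∧
      Function.Surjective T ∧
      rdCell h ∩ {x | 4 * h ^ 2 * (1 - ε) ≤ inner ℝ x ((2 * h) • intVec w)} ⊆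
        (fun x => p + T x) ''
          {x : E3 | ∀ i, ![-(ε / 2), -(ε / 2), -ε] i ≤ x i ∧ x i ≤ ![1 + ε / 2, 1 + ε / 2, 0] i} := by
  obtain ⟨g, -, hg', hgv⟩ := exists_symmetry_of_mem_fccInt h hw
  have base := rdCell_baseCap_subset_prism hh ε
  set T₀ := columnFrame (h • intVec ![-1, 1, 1]) (h • intVec ![-1, 1, -1]) (h • intVec ![1, 1, 0])
  have hG : ∀ u, ‖g.toLinearIsometry.toContinuousLinearMap u‖ = ‖u‖ := fun u => g.norm_map u
  have hlow := lower_row_comp_of_norm_eq _ T₀ hG (lower_row_baseFrame h hh.le)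
  have hv : g ((2 * h) • intVec ![1, 1, 0]) = (2 * h) • intVec w := by rw [map_smul, hgv]
  refine ⟨g ((2 * h) • intVec ![1, 0, 0]), g.toLinearIsometry.toContinuousLinearMap.comp T₀, ?_, hlow,
    surjective_of_lower_row _ (by positivity) hlow, ?_⟩
  · rw [abs_det_comp_of_norm_eq_left _ _ hG, abs_det_baseFrame h hh.le]
  · rw [← hv]
    exact cap_subset_prism_transport g (fun x hx => mem_of_isInvariantUnder hg' hx) base

end

end Summit.AtomisticToContinuum.Crystallization.Theorems.OverbindingBudgetAffineFarFieldCellFacets
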